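import Literature.Geometry.Lorentzian.KerrHorizonCausality
import Literature.Geometry.Lorentzian.KerrLeafCoercivity
import HarnessLib

/-!
# The metric gradient of the Kerr–Schild radius: `∇r = g⁻¹ dr = (0, ∇_E r) − 2H ℓ♯`,
# `g(∇r, ·) = dr`, `g(∇r, ∇r) = Δ/Σ`, `g(V, ∇r) = −2H`

(family `gr`; namespace `Literature.Geometry.Lorentzian.Kerr`)

In the ingoing Kerr–Schild chart `g = η + 2H ℓ ⊗ ℓ` (`Kerr.bilin`) the metric dual of the
differential `dr` of the Kerr–Schild radius `r = Kerr.radius a` is the explicit vector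

  `W = (0, ∇_E r) − 2H ℓ♯`,   `∇_E r = Kerr.radiusGradVec a x⃗` the Euclidean gradient,

because `ℓ(W) = ℓ⃗·∇_E r = 1` (`Kerr.radiusGrad_nullSpatial`) makes the two Kerr–Schild
correction terms cancel: `g(W, w) = η(W, w) + 2H ℓ(W) ℓ(w) = ⟨∇_E r, w⃗⟩ = dr(w)`. Consequently

* `Kerr.bilin_radiusGradVector` — `g(W, w) = dr(w)` for every `w`;
* `Kerr.bilin_radiusGradVector_self` — `g(W, W) = g⁻¹(dr, dr) = Δ(r)/Σ`,
  `Δ = r² − 2Mr + a²` (`|∇_E r|² = (r² + a²)/Σ`, `Kerr.inner_radiusGradVec_self`, and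
  `2HΣ = 2Mr`): the Boyer–Lindquist `g^{rr}`, NEGATIVE strictly between the horizons;
* `Kerr.bilin_timeVector_radiusGradVector` — `g(V, W) = −dt*(W) = −2H` for the orienting
  field `V = −g♯(dt*)`: where `W` is timelike (`r₋ < r < r₊`) and `M > 0` it is
  FUTURE-directed, so that `r` decreases along every future causal curve of region II
  (`Kerr.radiusGrad_lt_zero_of_isFutureDirected`, file `KerrRegionIISpeedBound`).

These are the identities behind "`r` is a time function on region II" (O'Neill 1995, §2.5) and
behind the finite timelike diameter of region II (file `KerrRegionIIDiameter`).

## References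

* B. O'Neill, *The Geometry of Kerr Black Holes*, A K Peters 1995, §2.4–§2.5 (`Δ`, the
  horizons, `grad r` timelike on region II). Key `ONeill1995`.
* M. Visser, *The Kerr spacetime: a brief introduction*, arXiv:0706.0622, (32)–(35)
  (Kerr–Schild form, `H = Mr³/(r⁴ + a²z²)`, `ℓ`, the quartic of `r`). Key `arXiv07060622`.
* M. Dafermos, I. Rodnianski, Y. Shlapentokh-Rothman, arXiv:1402.7034, §2.1.1
  (`Δ = r² − 2Mr + a²`, `Σ = ρ²`). Key `DafermosRodnianskiShlapentokhrothman2014`.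
-/

noncomputable section

open Set
open scoped RealInnerProductSpace

namespace Literature.Geometry.Lorentzian.Kerr

/-- **The metric gradient of the Kerr–Schild radius** as an explicit vector of `E4`:
`W = (0, ∇_E r) − 2H ℓ♯`, `∇_E r = Kerr.radiusGradVec a x⃗`, `ℓ♯ = Kerr.nullVector`
(so `W⁰ = 2H`, `Wⁱ = ∂ᵢr − 2H ℓᵢ`). It is `g⁻¹ dr` (`bilin_radiusGradVector`). O'Neill 1995,
§2.5 (`grad r`); Visser arXiv:0706.0622, (33)–(35). [cite: ONeill1995, §2.5] -/
def radiusGradVector (M a : ℝ) (x : E4) : E4 :=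
  E4.ofTimeSpace 0 (radiusGradVec a (E4.spatial x)) - (2 * scalarH M a x) • nullVector a x

/-- The time component `W⁰ = 2H` (`(ℓ♯)⁰ = −1`). [cite: arXiv07060622, (34)] -/
theorem radiusGradVector_apply_zero (M a : ℝ) (x : E4) :
    radiusGradVector M a x 0 = 2 * scalarH M a x := by
  simp [radiusGradVector, E4.ofTimeSpace_apply_zero]

/-- The spatial components `Wⁱ⁺¹ = ∂ᵢr − 2H ℓᵢ₊₁`. [cite: arXiv07060622, (34)] -/
theorem radiusGradVector_apply_succ (M a : ℝ) (x : E4) (i : Fin 3) :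
    radiusGradVector M a x i.succ =
      radiusGradVec a (E4.spatial x) i - 2 * scalarH M a x * nullCovectorFun a x i.succ := by
  have hnv : nullVector a x i.succ = nullCovectorFun a x i.succ := by
    fin_cases i
    · exact nullVector_apply_one a x
    · exact nullVector_apply_two a x
    · exact nullVector_apply_three a x
  simp [radiusGradVector, E4.ofTimeSpace_apply_succ, hnv]

/-- `ℓ(W) = 1`: `ℓ(W) = ℓ₀ W⁰ + ℓ⃗·(∇_E r − 2H ℓ⃗) = 2H + 1 − 2H |ℓ⃗|² = 1` (`ℓ⃗·∇_E r = 1`,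
`|ℓ⃗|² = 1`). Visser arXiv:0706.0622, (34)–(35). [cite: arXiv07060622, (34)–(35)] -/
theorem nullCovector_radiusGradVector {M a : ℝ} {x : E4} (hx : 0 < radius a x) :
    nullCovector a x (radiusGradVector M a x) = 1 := by
  have hlg := sum_nullCovectorFun_mul_radiusGradVec hx
  have hll := sum_sq_nullCovectorFun hx
  rw [nullCovector, E4.covector_apply, Fin.sum_univ_four]
  rw [show (1 : Fin 4) = (0 : Fin 3).succ from rfl, show (2 : Fin 4) = (1 : Fin 3).succ from rfl,
    show (3 : Fin 4) = (2 : Fin 3).succ from rfl]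
  simp only [radiusGradVector_apply_zero, radiusGradVector_apply_succ, nullCovectorFun_apply_zero]
  simp only [Fin.succ_zero_eq_one, Fin.succ_one_eq_two] at *
  have h3 : ((2 : Fin 3).succ : Fin 4) = 3 := rfl
  simp only [h3] at *
  linear_combination hlg - 2 * scalarH M a x * hll

/-- **`g(W, w) = dr(w)`**: the vector `W = (0, ∇_E r) − 2H ℓ♯` is the metric dual of `dr`,
`g(W, w) = η(W, w) + 2H ℓ(W) ℓ(w) = ⟨∇_E r, w⃗⟩ − 2H ℓ(w) + 2H ℓ(w) = dr(w)`. O'Neill 1995, §2.5;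
Visser arXiv:0706.0622, (32)–(35). [cite: ONeill1995, §2.5] -/
theorem bilin_radiusGradVector {M a : ℝ} {x : E4} (hx : 0 < radius a x) (w : E4) :
    bilin M a x (radiusGradVector M a x) w = radiusGrad a (E4.spatial x) (E4.spatial w) := by
  have hℓ := nullCovector_radiusGradVector (M := M) hx
  rw [bilin_apply, hℓ, one_mul, radiusGrad_apply_sum, Minkowski.bilin_apply, Fin.sum_univ_three,
    Fin.sum_univ_three]
  rw [nullCovector, E4.covector_apply, Fin.sum_univ_four]
  rw [show (1 : Fin 4) = (0 : Fin 3).succ from rfl, show (2 : Fin 4) = (1 : Fin 3).succ from rfl,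
    show (3 : Fin 4) = (2 : Fin 3).succ from rfl]
  simp only [radiusGradVector_apply_zero, radiusGradVector_apply_succ, nullCovectorFun_apply_zero,
    E4.spatial_apply]
  ring

/-- **`g(W, W) = Δ/Σ`**: `g(W, W) = dr(W) = |∇_E r|² − 2H ⟨∇_E r, ℓ⃗⟩ = (r² + a²)/Σ − 2Mr/Σ`
(`|∇_E r|² Σ = r² + a²`, `ℓ⃗·∇_E r = 1`, `HΣ = Mr`), i.e. the Boyer–Lindquist `g^{rr} = Δ/Σ`
with `Δ = r² − 2Mr + a²`. O'Neill 1995, §2.4–2.5; DRSR arXiv:1402.7034, §2.1.1.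
[cite: ONeill1995, §2.5; DafermosRodnianskiShlapentokhrothman2014, §2.1.1] -/
theorem bilin_radiusGradVector_self {M a : ℝ} {x : E4} (hx : 0 < radius a x) :
    bilin M a x (radiusGradVector M a x) (radiusGradVector M a x) =
      (radius a x ^ 2 - 2 * M * radius a x + a ^ 2) / blSigma a (E4.spatial x) := by
  have hlg := sum_nullCovectorFun_mul_radiusGradVec hx
  have hgg := sum_sq_radiusGradVec_mul_blSigma hx
  have hSpos : 0 < blSigma a (E4.spatial x) := blSigma_spatial_pos hx
  have hH : scalarH M a x * blSigma a (E4.spatial x) = M * radius a x := by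
    rw [scalarH_eq_div_blSigma M a hx]
    field_simp
  rw [bilin_radiusGradVector hx, radiusGrad_apply_sum, Fin.sum_univ_three]
  simp only [E4.spatial_apply]
  rw [show (0 : Fin 3).succ = (1 : Fin 4) from rfl, show (1 : Fin 3).succ = (2 : Fin 4) from rfl,
    show (2 : Fin 3).succ = (3 : Fin 4) from rfl]
  rw [show (1 : Fin 4) = (0 : Fin 3).succ from rfl, show (2 : Fin 4) = (1 : Fin 3).succ from rfl,
    show (3 : Fin 4) = (2 : Fin 3).succ from rfl]
  simp only [radiusGradVector_apply_succ]
  simp only [Fin.succ_zero_eq_one, Fin.succ_one_eq_two] at *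
  have h3 : ((2 : Fin 3).succ : Fin 4) = 3 := rfl
  simp only [h3] at *
  rw [eq_div_iff hSpos.ne']
  -- name the atoms
  obtain ⟨g0, hg0⟩ : ∃ g0, radiusGradVec a (E4.spatial x) 0 = g0 := ⟨_, rfl⟩
  obtain ⟨g1, hg1⟩ : ∃ g1, radiusGradVec a (E4.spatial x) 1 = g1 := ⟨_, rfl⟩
  obtain ⟨g2, hg2⟩ : ∃ g2, radiusGradVec a (E4.spatial x) 2 = g2 := ⟨_, rfl⟩
  obtain ⟨l1, hl1⟩ : ∃ l1, nullCovectorFun a x 1 = l1 := ⟨_, rfl⟩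
  obtain ⟨l2, hl2⟩ : ∃ l2, nullCovectorFun a x 2 = l2 := ⟨_, rfl⟩
  obtain ⟨l3, hl3⟩ : ∃ l3, nullCovectorFun a x 3 = l3 := ⟨_, rfl⟩
  obtain ⟨f, hf⟩ : ∃ f, scalarH M a x = f := ⟨_, rfl⟩
  obtain ⟨S, hS⟩ : ∃ S, blSigma a (E4.spatial x) = S := ⟨_, rfl⟩
  obtain ⟨r, hr⟩ : ∃ r, radius a x = r := ⟨_, rfl⟩
  rw [hg0, hg1, hg2, hl1, hl2, hl3] at hlg
  rw [hg0, hg1, hg2, hS, hr] at hgg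
  rw [hf, hS, hr] at hH
  rw [hg0, hg1, hg2, hl1, hl2, hl3, hf, hS, hr]
  linear_combination hgg - 2 * f * S * hlg - 2 * hH

/-- **`g(V, W) = −2H`** for the orienting field `V = −g♯(dt*)` (`g(V, w) = −w⁰`, and
`W⁰ = 2H`): since `H = Mr/Σ > 0` for `M > 0`, the timelike gradient `W` of region II lies in
the timecone of `V`, i.e. is future-directed. Dafermos–Rodnianski arXiv:0811.0354, §5.1;
O'Neill 1995, §2.5. [cite: ONeill1995, §2.5] -/
theorem bilin_timeVector_radiusGradVector {M a : ℝ} {x : E4} (hx : 0 < radius a x) :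
    bilin M a x (timeVector M a x) (radiusGradVector M a x) = -(2 * scalarH M a x) := by
  rw [bilin_timeVector hx, radiusGradVector_apply_zero]

/-- **`dr = g(W, ·)` is the differential of the radius**: `d(Kerr.radius a)_x(w) = g_x(W, w)`
(`Kerr.hasFDerivAt_radius` with `bilin_radiusGradVector`). O'Neill 1995, §2.5.
[cite: ONeill1995, §2.5] -/
theorem hasFDerivAt_radius_bilin {M a : ℝ} {x : E4} (hx : 0 < radius a x) :
    HasFDerivAt (radius a) (bilin M a x (radiusGradVector M a x)) x := by
  refine (hasFDerivAt_radius hx).congr_fderiv ?_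
  ext w
  rw [bilin_radiusGradVector hx]
  rfl

end Literature.Geometry.Lorentzian.Kerr

end
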